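import Literature.Computability.AlgebraicComplexity.FlipGraph222StdComponent
import HarnessLib

/-!
# The reduction edges of the standard algorithm's component (`(2,2,2)`, `ℤ₂`; KM 2023 §4: "7 of which are reductions")

Topic `Literature/Computability/AlgebraicComplexity`. Source: M. Kauers, J. Moosbauer, *Flip Graphs
for Matrix Multiplication*, ISSAC 2023 = arXiv:2212.01175 (KM), §4 / Fig. 1, on `K = ℤ₂`: the
connected component of the standard algorithm in the `(2,2,2)`-flip graph of rank at most `8` "has
`272` vertices … and `1183` edges, `7` of which are reductions". Def. 8: the edges are `E₁` (flips)
`∪ E₂` (reductions), between ORBITS, induced from representatives.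

## What is typed (everything PROVED, kernel replay; no definitions, no named facts)

With the `273` representatives `Comp222.creps` of `FlipGraph222StdComponent.lean` (whose orbits ARE
the component, `Comp222.kauersMoosbauer2023_fig1_component_eq`), the COMPLETE merge enumerator
`Cert222R.mergesAll` of `FlipGraph222ReductionEnum.lean` (KM Prop. 3) and a kernel table saying that
all merges of all but eight representatives are degenerate (`mergesDegenerate_*`):

* `reduction_edge_iff`: for listed orbits `cv i`, `cv j` there is an `E₂`-edge `cv i → cv j` — some
  scheme of the orbit `cv i` REDUCES (Def. 2 / Prop. 3, all six slot cases) to some scheme of the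
  orbit `cv j` — if and only if `j = 265` (Strassen's orbit, the only vertex of rank `7`) and
  `i ∈ {262, 263, 264, 266, 267, 268, 269, 270}`: three orbits reached from the standard algorithm
  by flips, and the five flip-wise hidden orbits `hs 0, …, hs 4` of `FlipGraph222HiddenOrbits.lean`;
* so the component has exactly EIGHT reduction edges, all into Strassen's orbit
  (`reduction_sources`); KM print "`7`" — their published vertex data lack the orbit of
  `creps[269] = hs 3`, whose only edge is its reduction into Strassen's orbit.

HONEST FRAMING: a statement about `⟨2,2,2⟩` over `ℤ₂`, KM's group `G` and KM's reductions
(Prop. 3) inside the rank-`≤ 8` component of the standard algorithm; edges are counted as ordered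
pairs of distinct orbits joined by a reduction (a reduction lowers the rank, so there is no double
counting and no loop). Flip edges (`1183 − 7`, with KM's loop convention) are not counted here.

## References

* M. Kauers, J. Moosbauer, *Flip Graphs for Matrix Multiplication*, ISSAC 2023, 381–388,
  doi:10.1145/3597066.3597120, arXiv:2212.01175: Def. 2, Prop. 3, Def. 8, Thm. 9, §4 and Fig. 1
  ("1183 edges, 7 of which are reductions"). [KauersMoosbauer2022FlipGraphs]
-/

set_option Elab.async false

namespace Literature.Computability.AlgebraicComplexity

open scoped BigOperators Kronecker
open Multiset Matrix

namespace FlipGraph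

namespace Comp222

open Cert222 Cert222R StdBall222 Hidden222

/-! ## §1 The degeneracy table (kernel) -/

/-- Degeneracy table, chunk 0 (`0 ≤ i < 46`): unless `i` is one of the eight listed sources, every
merge (KM Prop. 3 reduction, `Cert222R.mergesAll`) of `creps[i]` contains a zero factor (kernel
evaluation). [cite: KauersMoosbauer2022FlipGraphs, Def. 8 (`E₂`), Prop. 3, §4 ("7 of which are reductions")] -/
theorem mergesDegenerate_0 : ((List.range' 0 46).all fun i =>
    decide (i ∈ ([262, 263, 264, 266, 267, 268, 269, 270] : List ℕ)) || (mergesAll (creps.getD i [])).all hasZeroB) = true := by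
  decide +kernel

/-- Degeneracy table, chunk 1 (`46 ≤ i < 92`): unless `i` is one of the eight listed sources, every
merge (KM Prop. 3 reduction, `Cert222R.mergesAll`) of `creps[i]` contains a zero factor (kernel
evaluation). [cite: KauersMoosbauer2022FlipGraphs, Def. 8 (`E₂`), Prop. 3, §4 ("7 of which are reductions")] -/
theorem mergesDegenerate_1 : ((List.range' 46 46).all fun i =>
    decide (i ∈ ([262, 263, 264, 266, 267, 268, 269, 270] : List ℕ)) || (mergesAll (creps.getD i [])).all hasZeroB) = true := by
  decide +kernel

/-- Degeneracy table, chunk 2 (`92 ≤ i < 138`): unless `i` is one of the eight listed sources, every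
merge (KM Prop. 3 reduction, `Cert222R.mergesAll`) of `creps[i]` contains a zero factor (kernel
evaluation). [cite: KauersMoosbauer2022FlipGraphs, Def. 8 (`E₂`), Prop. 3, §4 ("7 of which are reductions")] -/
theorem mergesDegenerate_2 : ((List.range' 92 46).all fun i =>
    decide (i ∈ ([262, 263, 264, 266, 267, 268, 269, 270] : List ℕ)) || (mergesAll (creps.getD i [])).all hasZeroB) = true := by
  decide +kernel

/-- Degeneracy table, chunk 3 (`138 ≤ i < 184`): unless `i` is one of the eight listed sources, every
merge (KM Prop. 3 reduction, `Cert222R.mergesAll`) of `creps[i]` contains a zero factor (kernel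
evaluation). [cite: KauersMoosbauer2022FlipGraphs, Def. 8 (`E₂`), Prop. 3, §4 ("7 of which are reductions")] -/
theorem mergesDegenerate_3 : ((List.range' 138 46).all fun i =>
    decide (i ∈ ([262, 263, 264, 266, 267, 268, 269, 270] : List ℕ)) || (mergesAll (creps.getD i [])).all hasZeroB) = true := by
  decide +kernel

/-- Degeneracy table, chunk 4 (`184 ≤ i < 230`): unless `i` is one of the eight listed sources, every
merge (KM Prop. 3 reduction, `Cert222R.mergesAll`) of `creps[i]` contains a zero factor (kernel
evaluation). [cite: KauersMoosbauer2022FlipGraphs, Def. 8 (`E₂`), Prop. 3, §4 ("7 of which are reductions")] -/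
theorem mergesDegenerate_4 : ((List.range' 184 46).all fun i =>
    decide (i ∈ ([262, 263, 264, 266, 267, 268, 269, 270] : List ℕ)) || (mergesAll (creps.getD i [])).all hasZeroB) = true := by
  decide +kernel

/-- Degeneracy table, chunk 5 (`230 ≤ i < 273`): unless `i` is one of the eight listed sources, every
merge (KM Prop. 3 reduction, `Cert222R.mergesAll`) of `creps[i]` contains a zero factor (kernel
evaluation). [cite: KauersMoosbauer2022FlipGraphs, Def. 8 (`E₂`), Prop. 3, §4 ("7 of which are reductions")] -/
theorem mergesDegenerate_5 : ((List.range' 230 43).all fun i =>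
    decide (i ∈ ([262, 263, 264, 266, 267, 268, 269, 270] : List ℕ)) || (mergesAll (creps.getD i [])).all hasZeroB) = true := by
  decide +kernel

/-- Reading one entry of an `all` over a range (bookkeeping). [folklore] -/
private theorem all_range'_imp'' {f : ℕ → Bool} {a n : ℕ} (h : ((List.range' a n).all f) = true)
    (i : ℕ) (h₁ : a ≤ i) (h₂ : i < a + n) : f i = true := by
  rw [List.all_eq_true] at h
  exact h i (List.mem_range'_1.mpr ⟨h₁, h₂⟩)

/-- **All representatives:** unless `i` is a listed source, every merge of `creps[i]` is degenerate.
[cite: KauersMoosbauer2022FlipGraphs, Def. 8 (`E₂`), Prop. 3, §4 ("7 of which are reductions")] -/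
theorem merges_degenerate (i : ℕ) (hi : i < 273) (hn : i ∉ ([262, 263, 264, 266, 267, 268, 269, 270] : List ℕ)) :
    ((mergesAll (creps.getD i [])).all hasZeroB) = true := by
  have h : (decide (i ∈ ([262, 263, 264, 266, 267, 268, 269, 270] : List ℕ)) ||
      (mergesAll (creps.getD i [])).all hasZeroB) = true := by
    by_cases h0 : i < 46
    · exact all_range'_imp'' mergesDegenerate_0 i (by omega) (by omega)
    by_cases h1 : i < 92
    · exact all_range'_imp'' mergesDegenerate_1 i (by omega) (by omega)
    by_cases h2 : i < 138
    · exact all_range'_imp'' mergesDegenerate_2 i (by omega) (by omega)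
    by_cases h3 : i < 184
    · exact all_range'_imp'' mergesDegenerate_3 i (by omega) (by omega)
    by_cases h4 : i < 230
    · exact all_range'_imp'' mergesDegenerate_4 i (by omega) (by omega)
    exact all_range'_imp'' mergesDegenerate_5 i (by omega) (by omega)
  rwa [decide_eq_false hn, Bool.false_or] at h

/-! ## §2 No other reduction edges -/

/-- **Only the eight sources, only into Strassen's orbit:** if a scheme of the listed orbit `cv i`
reduces to a scheme of the listed orbit `cv j`, then `j = 265` and `i` is one of the eight sources
(equivariance of reductions, rank bookkeeping, completeness of the merge enumerator, and the
degeneracy table). [cite: KauersMoosbauer2022FlipGraphs, Def. 8 (`E₂`), Prop. 3, §4 ("7 of which are reductions")] -/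
theorem reduction_edge_only (i j : Fin 273) {x y : Scheme (matMulTensor (ZMod 2) 2 2 2)}
    (hx : Quotient.mk (orbitSetoidKM (ZMod 2) 2) x = (cv i).1)
    (hy : Quotient.mk (orbitSetoidKM (ZMod 2) 2) y = (cv j).1) (hred : Reduces x.elts y.elts) :
    j.val = 265 ∧ i.val ∈ ([262, 263, 264, 266, 267, 268, 269, 270] : List ℕ) := by
  obtain ⟨φ, hφ, hxφ⟩ : (orbitSetoidKM (ZMod 2) 2).r x (cs i) := Quotient.exact hx
  obtain ⟨ψ, -, hyψ⟩ : (orbitSetoidKM (ZMod 2) 2).r y (cs j) := Quotient.exact hy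
  have hred' : Reduces (cs i).elts (y.map φ).elts := by
    rw [hxφ, Scheme.map_elts, Scheme.map_elts]
    exact hφ.map_flips_reduces.2.1 _ _ hred
  have hcard := hred'.card_lt
  rw [Scheme.map_elts, Multiset.card_map] at hcard
  have hri : Multiset.card (cs i).elts ≤ 8 := by
    have h := rank_cs i
    rw [Scheme.rank] at h
    split_ifs at h <;> omega
  have hrj : Multiset.card (cs j).elts = Multiset.card y.elts := by
    rw [hyψ, Scheme.map_elts, Multiset.card_map]
  have hj : j.val = 265 := by
    by_contra hne
    have h := rank_cs j
    rw [Scheme.rank, if_neg hne] at h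
    omega
  refine ⟨hj, ?_⟩
  by_contra hn
  have hcl := closureB_all i.val i.isLt
  simp only [closureB, Bool.and_eq_true] at hcl
  have hred'' : Reduces (elts3 (creps.getD i.val [])) (y.map φ).elts := by rw [← cs_elts]; exact hred'
  obtain ⟨r, hr, hyr⟩ := exists_mem_mergesAll_of_reduces hcl.1.1 hcl.1.2 hred''
  have hz := hasZeroB_eq_false (y.map φ) hyr
  have hall := merges_degenerate i.val i.isLt hn
  rw [List.all_eq_true] at hall
  have h := hall r hr
  rw [hz] at h
  exact Bool.false_ne_true h

/-! ## §3 The eight reduction edges -/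

/-- Packaging an edge from representatives (bookkeeping). [cite: KauersMoosbauer2022FlipGraphs, Def. 8] -/
private theorem edge_of_reps (i j : Fin 273) {x : Scheme (matMulTensor (ZMod 2) 2 2 2)}
    (hx : (orbitSetoidKM (ZMod 2) 2).r (cs i) x) (h : Reduces x.elts (cs j).elts) :
    ∃ x y : Scheme (matMulTensor (ZMod 2) 2 2 2),
      Quotient.mk (orbitSetoidKM (ZMod 2) 2) x = (cv i).1 ∧
      Quotient.mk (orbitSetoidKM (ZMod 2) 2) y = (cv j).1 ∧ Reduces x.elts y.elts :=
  ⟨x, cs j, (Quotient.sound hx).symm, rfl, h⟩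

/-- Strassen's orbit representative presents `LS`. [cite: KauersMoosbauer2022FlipGraphs, §4] -/
private theorem cs265_elts : (cs ⟨265, by omega⟩).elts = elts3 LS := by
  rw [cs_elts]; exact congrArg elts3 table_facts.2.2.2.2.1

/-- The five hidden sources `266 + k = hs k`, `k ≤ 4`, reduce to Strassen's orbit.
[cite: KauersMoosbauer2022FlipGraphs, §3 (splits), Prop. 3] -/
private theorem reduces_cs_hidden (k : Fin 7) (hk : k.val ≤ 4) :
    Reduces (cs ⟨266 + k.val, by omega⟩).elts (cs ⟨265, by omega⟩).elts := by
  rw [cs265_elts, ← V8_elts, cs_elts]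
  have h : creps.getD (266 + k.val) [] = hidden.getD k.val [] := table_facts.2.2.2.2.2.2 k
  rw [h, ← hs_elts]
  exact reduces_hs_V8 k hk

/-- Source `262`: its image under the word `(0, 0, 3, 1)` is a split of `LS` (merge in the first
slot: `11 = 8 ⊕ 3`). [cite: KauersMoosbauer2022FlipGraphs, §3 (splits), Prop. 3] -/
private theorem reduces_cs262 :
    Reduces ((cs ⟨262, by omega⟩).map (symOf (0, 0, 3, 1))).elts (cs ⟨265, by omega⟩).elts := by
  have hbd : ∀ t ∈ creps.getD 262 [], bdB t = true := by decide +kernel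
  rw [Scheme.map_elts, cs_elts, map_symOf_elts3 _ (by decide) _ hbd, cs265_elts]
  have e : (creps.getD 262 []).map (actTri (0, 0, 3, 1)) =
      [(8, 9, 13), (8, 5, 2), (10, 1, 15), (4, 12, 1), (3, 10, 8), (3, 9, 13), (1, 3, 12), (15, 8, 5)] := by
    decide +kernel
  have h₁ : elts3 [(8, 9, 13), (8, 5, 2), (10, 1, 15), (4, 12, 1), (3, 10, 8), (3, 9, 13), (1, 3, 12), (15, 8, 5)] =
      triad (dec 11 - dec 3) (dec 9) (dec 13) ::ₘ triad (dec 3) (dec 9) (dec 13) ::ₘ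
      elts3 [(1, 3, 12), (3, 10, 8), (4, 12, 1), (8, 5, 2), (10, 1, 15), (15, 8, 5)] := by
    decide +kernel
  have h₂ : elts3 LS = triad (dec 11) (dec 9) (dec 13) ::ₘ
      elts3 [(1, 3, 12), (3, 10, 8), (4, 12, 1), (8, 5, 2), (10, 1, 15), (15, 8, 5)] := by
    decide +kernel
  rw [e, h₁, h₂]
  exact reduces_of_split₁ _ _ _ _ _

/-- Source `263`: its image under the word `(0, 0, 3, 1)` is a split of `LS` (merge in the third
slot: `2 = 15 ⊕ 13`). [cite: KauersMoosbauer2022FlipGraphs, §3 (splits), Prop. 3] -/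
private theorem reduces_cs263 :
    Reduces ((cs ⟨263, by omega⟩).map (symOf (0, 0, 3, 1))).elts (cs ⟨265, by omega⟩).elts := by
  have hbd : ∀ t ∈ creps.getD 263 [], bdB t = true := by decide +kernel
  rw [Scheme.map_elts, cs_elts, map_symOf_elts3 _ (by decide) _ hbd, cs265_elts]
  have e : (creps.getD 263 []).map (actTri (0, 0, 3, 1)) =
      [(8, 5, 15), (8, 5, 13), (10, 1, 15), (4, 12, 1), (3, 10, 8), (11, 9, 13), (1, 3, 12), (15, 8, 5)] := by
    decide +kernel
  have h₁ : elts3 [(8, 5, 15), (8, 5, 13), (10, 1, 15), (4, 12, 1), (3, 10, 8), (11, 9, 13), (1, 3, 12), (15, 8, 5)] =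
      triad (dec 8) (dec 5) (dec 2 - dec 13) ::ₘ triad (dec 8) (dec 5) (dec 13) ::ₘ
      elts3 [(1, 3, 12), (3, 10, 8), (4, 12, 1), (10, 1, 15), (11, 9, 13), (15, 8, 5)] := by
    decide +kernel
  have h₂ : elts3 LS = triad (dec 8) (dec 5) (dec 2) ::ₘ
      elts3 [(1, 3, 12), (3, 10, 8), (4, 12, 1), (10, 1, 15), (11, 9, 13), (15, 8, 5)] := by
    decide +kernel
  rw [e, h₁, h₂]
  exact reduces_of_split₃ _ _ _ _ _

/-- Source `264`: its image under the word `(0, 0, 3, 1)` is a split of `LS` (merge in the first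
slot: `10 = 8 ⊕ 2`). [cite: KauersMoosbauer2022FlipGraphs, §3 (splits), Prop. 3] -/
private theorem reduces_cs264 :
    Reduces ((cs ⟨264, by omega⟩).map (symOf (0, 0, 3, 1))).elts (cs ⟨265, by omega⟩).elts := by
  have hbd : ∀ t ∈ creps.getD 264 [], bdB t = true := by decide +kernel
  rw [Scheme.map_elts, cs_elts, map_symOf_elts3 _ (by decide) _ hbd, cs265_elts]
  have e : (creps.getD 264 []).map (actTri (0, 0, 3, 1)) =
      [(8, 1, 15), (8, 5, 2), (2, 1, 15), (4, 12, 1), (3, 10, 8), (11, 9, 13), (1, 3, 12), (15, 8, 5)] := by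
    decide +kernel
  have h₁ : elts3 [(8, 1, 15), (8, 5, 2), (2, 1, 15), (4, 12, 1), (3, 10, 8), (11, 9, 13), (1, 3, 12), (15, 8, 5)] =
      triad (dec 10 - dec 2) (dec 1) (dec 15) ::ₘ triad (dec 2) (dec 1) (dec 15) ::ₘ
      elts3 [(1, 3, 12), (3, 10, 8), (4, 12, 1), (8, 5, 2), (11, 9, 13), (15, 8, 5)] := by
    decide +kernel
  have h₂ : elts3 LS = triad (dec 10) (dec 1) (dec 15) ::ₘ
      elts3 [(1, 3, 12), (3, 10, 8), (4, 12, 1), (8, 5, 2), (11, 9, 13), (15, 8, 5)] := by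
    decide +kernel
  rw [e, h₁, h₂]
  exact reduces_of_split₁ _ _ _ _ _

/-- **The eight reduction edges exist:** each listed source has a scheme reducing to a scheme of
Strassen's orbit. [cite: KauersMoosbauer2022FlipGraphs, Def. 8 (`E₂`), Prop. 3, §4 ("7 of which are reductions")] -/
theorem reduction_edge_of_mem (i : Fin 273) (hi : i.val ∈ ([262, 263, 264, 266, 267, 268, 269, 270] : List ℕ)) :
    ∃ x y : Scheme (matMulTensor (ZMod 2) 2 2 2),
      Quotient.mk (orbitSetoidKM (ZMod 2) 2) x = (cv i).1 ∧
      Quotient.mk (orbitSetoidKM (ZMod 2) 2) y = (cv ⟨265, by omega⟩).1 ∧ Reduces x.elts y.elts := by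
  have hrefl : ∀ i' : Fin 273, (orbitSetoidKM (ZMod 2) 2).r (cs i') (cs i') := fun i' =>
    (orbitSetoidKM (ZMod 2) 2).iseqv.refl _
  have hmap : ∀ (i' : Fin 273) (g : ℕ × ℕ × ℕ × ℕ),
      (orbitSetoidKM (ZMod 2) 2).r (cs i') ((cs i').map (symOf g)) := fun i' g =>
    ⟨symOf g, inSymmetryGroup_symOf g, rfl⟩
  simp only [List.mem_cons, List.not_mem_nil, or_false] at hi
  obtain ⟨i, hi273⟩ := i
  simp only at hi
  rcases hi with rfl | rfl | rfl | rfl | rfl | rfl | rfl | rfl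
  · exact edge_of_reps _ _ (hmap _ _) reduces_cs262
  · exact edge_of_reps _ _ (hmap _ _) reduces_cs263
  · exact edge_of_reps _ _ (hmap _ _) reduces_cs264
  · exact edge_of_reps _ _ (hrefl _) (reduces_cs_hidden ⟨0, by omega⟩ (by decide))
  · exact edge_of_reps _ _ (hrefl _) (reduces_cs_hidden ⟨1, by omega⟩ (by decide))
  · exact edge_of_reps _ _ (hrefl _) (reduces_cs_hidden ⟨2, by omega⟩ (by decide))
  · exact edge_of_reps _ _ (hrefl _) (reduces_cs_hidden ⟨3, by omega⟩ (by decide))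
  · exact edge_of_reps _ _ (hrefl _) (reduces_cs_hidden ⟨4, by omega⟩ (by decide))

/-- **KM §4 / Fig. 1, the reduction edges, in the kernel:** between the vertices `cv i`, `cv j` of
the component of the standard algorithm (all its vertices, by
`kauersMoosbauer2023_fig1_component_eq`) there is a reduction edge of KM's flip graph (`E₂` of
Def. 8: a scheme of the first orbit reduces, in the sense of Prop. 3, to a scheme of the second) if
and only if `cv j` is Strassen's orbit (`j = 265`) and `i` is one of EIGHT sources: `262, 263, 264`
(reached from the standard algorithm by flips) and `266, …, 270` (the flip-wise hidden `hs 0, …,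
hs 4`). KM print "`7` … reductions" (their vertex data lack the orbit of `creps[269] = hs 3`).
[cite: KauersMoosbauer2022FlipGraphs, Def. 8 (`E₂`), Prop. 3, §4 ("7 of which are reductions")] -/
theorem reduction_edge_iff (i j : Fin 273) :
    (∃ x y : Scheme (matMulTensor (ZMod 2) 2 2 2),
      Quotient.mk (orbitSetoidKM (ZMod 2) 2) x = (cv i).1 ∧
      Quotient.mk (orbitSetoidKM (ZMod 2) 2) y = (cv j).1 ∧ Reduces x.elts y.elts) ↔
    j.val = 265 ∧ i.val ∈ ([262, 263, 264, 266, 267, 268, 269, 270] : List ℕ) := by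
  constructor
  · rintro ⟨x, y, hx, hy, hred⟩
    exact reduction_edge_only i j hx hy hred
  · rintro ⟨hj, hi⟩
    obtain ⟨j, hj273⟩ := j
    simp only at hj
    subst hj
    exact reduction_edge_of_mem i hi

/-- Two schemes with the same elements are equal (bookkeeping). [folklore] -/
private theorem scheme_ext' {t₀ : T} {x y : Scheme t₀} (h : x.elts = y.elts) : x = y := by
  cases x; cases y; cases h; rfl

/-- Index `265` is Strassen's orbit (the vertex `vtxStrassen` of `FlipGraphStdStrassenDistance.lean`).
[cite: KauersMoosbauer2022FlipGraphs, §4 ("The component also contains Strassen's algorithm")] -/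
theorem cv_265_eq_vtxStrassen : cv ⟨265, by omega⟩ = vtxStrassen := by
  apply Subtype.ext
  show Quotient.mk _ (cs ⟨265, by omega⟩) = Quotient.mk _ StdToStrassenZ2.strassen
  have hV8 : cs ⟨265, by omega⟩ = StdToStrassenZ2.V8 :=
    scheme_ext' (by rw [cs_elts, V8_elts]; exact congrArg elts3 table_facts.2.2.2.2.1)
  rw [hV8]
  exact (Quotient.sound StdToStrassenZ2.equiv_strassen).symm

/-- **The reduction edges of the component, stated with `vtxStrassen`:** the listed orbit `cv i`
carries a reduction edge into Strassen's orbit iff `i` is one of the eight sources, and it carries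
no reduction edge into any other vertex of the component. [cite: KauersMoosbauer2022FlipGraphs, Def. 8 (`E₂`), Prop. 3, §4 ("7 of which are reductions")] -/
theorem reduction_edge_vtxStrassen_iff (i : Fin 273) :
    (∃ x y : Scheme (matMulTensor (ZMod 2) 2 2 2),
      Quotient.mk (orbitSetoidKM (ZMod 2) 2) x = (cv i).1 ∧
      Quotient.mk (orbitSetoidKM (ZMod 2) 2) y = vtxStrassen.1 ∧ Reduces x.elts y.elts) ↔
    i.val ∈ ([262, 263, 264, 266, 267, 268, 269, 270] : List ℕ) := by
  rw [← cv_265_eq_vtxStrassen, reduction_edge_iff]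
  exact ⟨fun h => h.2, fun h => ⟨rfl, h⟩⟩

/-- **Hence exactly eight reduction edges, all into Strassen's orbit:** the set of indices `i` whose
orbit `cv i` carries a reduction edge to some vertex of the component is the eight-element list of
sources. [cite: KauersMoosbauer2022FlipGraphs, Def. 8 (`E₂`), Prop. 3, §4 ("7 of which are reductions")] -/
theorem reduction_sources :
    (∀ i : Fin 273, (∃ j : Fin 273, ∃ x y : Scheme (matMulTensor (ZMod 2) 2 2 2),
      Quotient.mk (orbitSetoidKM (ZMod 2) 2) x = (cv i).1 ∧
      Quotient.mk (orbitSetoidKM (ZMod 2) 2) y = (cv j).1 ∧ Reduces x.elts y.elts) ↔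
      i.val ∈ ([262, 263, 264, 266, 267, 268, 269, 270] : List ℕ)) ∧
    ([262, 263, 264, 266, 267, 268, 269, 270] : List ℕ).Nodup ∧ ([262, 263, 264, 266, 267, 268, 269, 270] : List ℕ).length = 8 := by
  refine ⟨fun i => ⟨?_, fun hi => ⟨⟨265, by omega⟩, reduction_edge_of_mem i hi⟩⟩, by decide, rfl⟩
  rintro ⟨j, x, y, hx, hy, hred⟩
  exact (reduction_edge_only i j hx hy hred).2

end Comp222

end FlipGraph

end Literature.Computability.AlgebraicComplexity
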